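import Summits.ABC.IUTFork.Cor312Bridge
import HarnessLib

/-!
# The fork at [IUTchIII] Corollary 3.12 — COARSE versus FINE possible images over one volume container

Record-only file (D-0012) of the abc-iut cell (Cor. 3.12 sub-crew, wave 2, seat abc-iut-c312-6, board row W2-C′);
TAKES NO SIDE. Theorems only. The skeleton (`ForkRegions`, XVII) states Cor. 3.12 over a `Cor312Setting`: a volume
container, the POSSIBLE IMAGES `U_λ` of the Θ-pilot object ("which we regard as subject to the indeterminacies
(Ind1), (Ind2), (Ind3)", [IUTchIII] Cor. 3.12, kurims `paper:url-4b091feeb646` p. 173 l. 49 – p. 174 l. 3), the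
`q`-pilot image `Q`, and `Cor312 : −|log(q)| ≤ −|log(Θ)| := ln ν̄(hull(⋃_λ U_λ))`. The indeterminacies acting on the
multiradial representation come in (at least) two printed strengths over the SAME container and `q`-image:

* FINE — [IUTchIII] Thm. 3.11 (i) (Ind2) p. 154: "the indeterminacies induced by the action of independent copies
  of Ism [cf. Prop. 1.2 (vi)] … on each of the direct summands of the `j+1` factors" (per factor, per summand;
  c312-1 `Ind2Family`);
* COARSE — Dupuy–Hilado §4.9 (`paper:arxiv-2004.13228`): "They act through the group `Aut_{ℚ_p}(K_{v⃗} : I_{v⃗}) =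
  {φ ∈ Vect_{ℚ_p}(K_{v⃗}, K_{v⃗}) : φ(I_{v⃗}) ⊂ I_{v⃗}}`" (§4.11 "The (Coarse) Multiradial Representation"; [IUTchIV]
  Prop. 1.2 / Thm. 1.10 Step (v) p. 27 "(Ind1), (Ind2) are taken into account by the arbitrary nature of `φ`") —
  every fine possible image lies in a coarse one (RQ7 note R7-C3-N3, seat abc-iut-L6-t24, 2026-08-25T21:45Z).

Recorded here, at the skeleton level and PROVED (monotonicity of `ln ν̄` + of the hull, nothing else):

* `negLogTheta_le_of_iUnion_subset`: enlarging the union of the possible images can only ENLARGE `−|log(Θ)|`;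
* `cor312_coarse_of_cor312` / `not_cor312_of_not_cor312_coarse`: the FINE inequality implies the COARSE one over
  the same container and `q`-image — so Dupuy–Hilado's (1.1) for the coarse `U_Θ` is IMPLIED BY the verbatim
  statement once the two are read in one container (the direction every downstream consumer uses: (1.1) ∧ the
  upper bound of [IUTchIV] Thm. 1.10, proved for the coarse `φ`-group, give the squeeze), and a kernel refutation of
  the COARSE form would refute the verbatim one;
* `coarse_not_imp_fine`: the converse FAILS in an honest `(ℝ, Lebesgue)` container (fine image `[0,1]`, coarse
  image `[0,5]`, `q`-image `[0,3]`: `log 3 ≤ log 5` but `¬ log 3 ≤ 0`) — an equality "coarse hull-volume = fine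
  hull-volume" (what `Cor312Bridge.VerbatimDHAgreement` would need between a verbatim setting and a coarse DH
  datum) is a genuine extra claim, asserted by no declaration in the tree.

[claim: Mochizuki2012, status: disputed] [cite: DupuyHilado2025, §4.9, §4.11] Deliberately NOT here: whether the
verbatim `−|log(Θ)|` EQUALS the coarse one for the real instances; any judgement.
-/

noncomputable section

open Set

namespace Summit.ABC

namespace IUTFork

namespace Cor312Vol

/-! ## 1. Coarser possible images, same container and `q`-image -/

section CoarseFine

variable (C : Cor312Setting) {I' : Type} (U' : I' → Set C.L) (hU' : ∀ i, C.Adm (U' i))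
  (hhol' : C.Adm (C.hull (⋃ i, U' i)))

/-- **Enlarging the union of the possible images enlarges `−|log(Θ)|`**: if `⋃_λ U_λ ⊆ ⋃_{λ'} U'_{λ'}` in one volume
container (both hulls admissible), then `ln ν̄(hull(⋃ U)) ≤ ln ν̄(hull(⋃ U'))` — monotonicity of the hull ((P3) of
[IUTchIII] Rmk. 3.9.5 (ii)) and of the log-volume. [folklore] -/
theorem negLogTheta_le_of_iUnion_subset (hsub : (⋃ i, C.U i) ⊆ ⋃ i, U' i) :
    C.negLogTheta ≤
      ({ C with Idx := I', U := U', U_adm := hU', Uhol_adm := hhol' } : Cor312Setting).negLogTheta :=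
  C.logvol_mono C.adm_Uhol hhol' (C.hull.monotone hsub)

/-- The same under "every fine possible image lies in SOME coarse possible image" (the shape of R7-C3-N3: a family
of independent per-factor lattice isomorphisms IS a `φ` stabilising the tensor lattice). [folklore] -/
theorem negLogTheta_le_of_forall_exists_subset (hsub : ∀ i, ∃ i', C.U i ⊆ U' i') :
    C.negLogTheta ≤
      ({ C with Idx := I', U := U', U_adm := hU', Uhol_adm := hhol' } : Cor312Setting).negLogTheta :=
  negLogTheta_le_of_iUnion_subset C U' hU' hhol' (Set.iUnion_subset fun i => by
    obtain ⟨i', hi'⟩ := hsub i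
    exact hi'.trans (Set.subset_iUnion U' i'))

/-- **FINE ⟹ COARSE**: over one container and one `q`-image, the Cor-3.12 inequality for the finer possible images
implies it for the coarser ones (Dupuy–Hilado's (1.1) for the coarse `U_Θ` is implied by the verbatim statement
read in the same container). [cite: DupuyHilado2025, §4.11] -/
theorem cor312_coarse_of_cor312 (hsub : (⋃ i, C.U i) ⊆ ⋃ i, U' i) (h : C.Cor312) :
    ({ C with Idx := I', U := U', U_adm := hU', Uhol_adm := hhol' } : Cor312Setting).Cor312 :=
  le_trans h (negLogTheta_le_of_iUnion_subset C U' hU' hhol' hsub)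

/-- Contrapositive: a refutation of the COARSE inequality refutes the FINE one. [folklore] -/
theorem not_cor312_of_not_cor312_coarse (hsub : (⋃ i, C.U i) ⊆ ⋃ i, U' i)
    (h : ¬ ({ C with Idx := I', U := U', U_adm := hU', Uhol_adm := hhol' } : Cor312Setting).Cor312) :
    ¬ C.Cor312 :=
  fun hC => h (cor312_coarse_of_cor312 C U' hU' hhol' hsub hC)

/-- The LANA §8.3 reading transfers upward too: a fine possible image with the `q`-pilot volume is contained in a
coarse one of at least that volume, so `−|log(q)| ≤ −|log(Θ)|_coarse` (via `logvol_U_le_negLogTheta`). [folklore] -/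
theorem cor312_coarse_of_representedVol (hsub : (⋃ i, C.U i) ⊆ ⋃ i, U' i) (h : C.RepresentedVol) :
    ({ C with Idx := I', U := U', U_adm := hU', Uhol_adm := hhol' } : Cor312Setting).Cor312 :=
  cor312_coarse_of_cor312 C U' hU' hhol' hsub (C.cor312_of_representedVol h)

end CoarseFine

/-! ## 2. The converse fails in an honest container -/

section Witness

/-- The assembled hull of the toy family (identity packet hulls) fixes every box `Π [a,b]`, `a ≤ b`. [folklore] -/
theorem toyFamily_hull_toyBox {a b : ℝ} (h : a ≤ b) :
    toyFamily.assemble.hull (⋃ _ : Unit, toyBox a b) = toyBox a b := by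
  rw [Set.iUnion_const]
  show boxHull (fun _ : Unit => ClosureOperator.id (Set (Unit → ℝ)))
      (Set.univ.pi fun _ : Unit => toyInterval a b) = toyBox a b
  rw [boxHull_pi _ _ (fun _ => toyInterval_nonempty h)]
  rfl

/-- **COARSE does NOT imply FINE**: in the `(ℝ, Lebesgue)` container of `Cor312Bridge` (fine possible image
`[0,1]`, coarse possible image `[0,5] ⊇ [0,1]`, the same `q`-image `[0,3]`) the coarse inequality holds
(`log 3 ≤ log 5`) and the fine one fails (`¬ log 3 ≤ 0`). So an identification "coarse hull-volume = fine
hull-volume" is a genuine additional claim; the tree asserts it nowhere. [folklore] -/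
theorem coarse_not_imp_fine :
    ∃ (C : Cor312Setting) (I' : Type) (U' : I' → Set C.L) (hU' : ∀ i, C.Adm (U' i))
      (hhol' : C.Adm (C.hull (⋃ i, U' i))),
      (⋃ i, C.U i) ⊆ (⋃ i, U' i) ∧
        ({ C with Idx := I', U := U', U_adm := hU', Uhol_adm := hhol' } : Cor312Setting).Cor312 ∧ ¬ C.Cor312 := by
  have hhol : toyFamily.assemble.Adm (toyFamily.assemble.hull (⋃ _ : Unit, toyBox 0 5)) := by
    rw [toyFamily_hull_toyBox (by norm_num : (0 : ℝ) ≤ 5)]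
    exact toyBox_adm (by norm_num)
  refine ⟨toySetting 0 3 (by norm_num), Unit, fun _ => toyBox 0 5, fun _ => toyBox_adm (by norm_num), hhol,
    ?_, ?_, fun h => ?_⟩
  · exact Set.iUnion_subset fun _ => (Set.pi_mono fun _ _ => Set.pi_mono fun _ _ =>
      Set.Icc_subset_Icc le_rfl (by norm_num)).trans (Set.subset_iUnion (fun _ : Unit => toyBox 0 5) ())
  · show toyFamily.assemble.logvol (toyBox 0 3) ≤
      toyFamily.assemble.logvol (toyFamily.assemble.hull (⋃ _ : Unit, toyBox 0 5))
    rw [toyFamily_hull_toyBox (by norm_num : (0 : ℝ) ≤ 5), toyFamily_logvol (by norm_num : (0 : ℝ) < 5),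
      toyFamily_logvol (by norm_num : (0 : ℝ) < 3), sub_zero, sub_zero]
    exact Real.log_le_log (by norm_num) (by norm_num)
  · have h3 := (toySetting_cor312_iff 0 3 (by norm_num)).mp h
    rw [sub_zero] at h3
    exact absurd h3 (not_le.mpr (Real.log_pos (by norm_num)))

/-- Hence `Cor312` is NOT invariant under replacing the possible images by a coarser family containing them: the
two printed strengths of the indeterminacies are different conditions on the same data. [folklore] -/
theorem cor312_not_invariant_under_coarsening :
    ¬ ∀ (C : Cor312Setting) (I' : Type) (U' : I' → Set C.L) (hU' : ∀ i, C.Adm (U' i))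
      (hhol' : C.Adm (C.hull (⋃ i, U' i))), (⋃ i, C.U i) ⊆ (⋃ i, U' i) →
        (({ C with Idx := I', U := U', U_adm := hU', Uhol_adm := hhol' } : Cor312Setting).Cor312 ↔ C.Cor312) := by
  intro h
  obtain ⟨C, I', U', hU', hhol', hsub, hcoarse, hfine⟩ := coarse_not_imp_fine
  exact hfine ((h C I' U' hU' hhol' hsub).1 hcoarse)

end Witness

end Cor312Vol

end IUTFork

end Summit.ABC

end
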